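import Mathlib
import HarnessLib
import HarnessLib.Audit
import Summits.ValiantsHypothesis.Statement
import Literature.Computability.AlgebraicComplexity.CircuitDepth
import Literature.Computability.AlgebraicComplexity.StandardFamiliesProofs
import Literature.Computability.AlgebraicComplexity.ValiantConjectureProofs
import Summits.ValiantsHypothesis.ValiantsHypothesis.Theorems.SymPencilHubPerNotVp
import Summits.ValiantsHypothesis.ValiantsHypothesis.Theorems.ChowBorderDepth3SPSNormalForm
import Summits.ValiantsHypothesis.ValiantsHypothesis.Theorems.ChowBorderDepth3Assembly
import Summits.ValiantsHypothesis.ValiantsHypothesis.Theorems.ChowBorderDepth3Depth3Chasm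
import HarnessLib.Audit.Status.Attr

/-!
Route: SummationBits

DORMANT since 2026-08-26T12:04:54Z (reconciler: no traction for 8.2 d (last activity item-evidence-added at 2026-08-18T06:27:25Z); parked, not closed — `ledger route dormant route-ValiantsHypothesis-SummationBits --off` to reactivate) — unstaffed, not closed; items shared with open routes are served there. `ledger route dormant <id> --off` reactivates.

# Route SummationBits — summation bits of the permanent — Ryser-optimal depth three beneath the
chasm, with the positive and homogeneous rungs as theorems

It suffices to show X = Depth3Thesis (the decl is SHARED verbatim with route ChowBorderDepth3,
opened today for a border-apolarity
card): for every c there is n such that no arithmetic circuit over ℂ of product-depth ≤ 1 (a ΣΠΣ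
circuit: weighted sums of products
of affine forms) with at most (n+2)^(c⌊√n⌋+c) WIRES computes per_n. In the language of card
summation-bits-ladder (spine and only card)
this is Rung 3 of the dial ν(per_n) = log₂(number of summands): with ΠΣ integrands charged by their
degree (wires), log₂(wires) is not
O(√n·log n), i.e. "n^(ω(√n)) summands/wires at depth three". Over ℂ it is sufficient by the depth-3
chasm (crux Depth3Chasm, shared). This route is
the EXACT (non-border) decomposition of the shared target by COUNTING: Ryser-optimality of the wire
count (RyserOptimalDepth3, rank 3),
the first exponential rung 2^(⌊√n⌋/c) (ExpSqrtDepth3, rank 4), and the two rungs of the dial that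
are theorems today — the positive rung
(Theorem A of the card: PositiveWitnessBound/Construction, ν⁺ = n log₂n − n log₂log₂n ± O(n)) and
the homogeneous rung (HomogeneousRung,
C(n,⌊n/2⌋) summands, Nisan–Wigderson) — filed as provable-now support.
Lean: `∀ c : ℕ, ∃ n : ℕ, ∀ P : Literature.Computability.AlgebraicComplexity.ArithCircuit ℂ (Fin n ×
Fin n), P.Computes (Literature.Computability.AlgebraicComplexity.perPoly (Fin n) ℂ) → P.productDepth
≤ 1 → (n + 2) ^ (c * Nat.sqrt n + c) < P.edgeSize`

## Assembly
Pure bookkeeping, sorry-free in Sketch.lean (`assembly_holds`), and SHARED verbatim with route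
ChowBorderDepth3 so that one proof serves
both routes: were VP = VNP, the permanent family would be a VP family (renaming bridge + Valiant's
per ∈ VNP), Depth3Chasm would give c
and, for every n, a product-depth-≤1 circuit with ≤ (n+2)^(c⌊√(deg per_n)⌋+c) = (n+2)^(c⌊√n⌋+c)
wires (deg per_n = n, tree fact
`totalDegree_perPoly`, inlined as a hypothesis), contradicting Depth3Thesis at that c.
RyserOptimalDepth3 reaches the thesis through
RyserToThesis + SPSNormalForm; GateCountSuffices lets a gate-count proof (the currency of the tree's
LST machinery) count as well.

Rationale: WHY THIS LINE. The mechanism is one integer dial — the number of summands (equivalently, wires) of a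
depth-three representation of per_n — read from
the top: n! (list the permutations), 2^(n log₂log₂n + Θ(n)) (best POSITIVE decomposition: Theorem A,
new, provable now from the tree's
balanced decomposition `ArithCircuit.exists_balanced_decomposition` over ℝ≥0, JerrumSnir1982 /
ChattopadhyayDattaGhosalMukhopadhyay2022
Thm 2.1), C(n,⌊n/2⌋)…2^n (homogeneous: NisanWigderson1996, Landsberg2017 Prop 7.2.2.1, provable now
from the tree's PROVED
`flatteningRank_perPoly`), n·2^n (Ryser 1963 / Glynn2010, inhomogeneous and exact — conjectured
optimal up to poly(n), crux 3), and at
the bottom the chasm threshold (n+2)^(Θ(√n)) where det_n provably sits (Tavenas2015 p.3,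
GuptaKamathKayalSaptharishi2016) and where
per_n would sit if VP = VNP. Imported areas: extremal combinatorics of monotone computation (the max
monotone-cheap sub-support of S_n),
catalecticant geometry (flattenings) for the homogeneous rung, and exponential-time counting as the
foil — Björklund's Boolean
2^(n−Ω(√(n/log n))) permanent algorithm (arXiv:1211.0391) and Bax–Franklin
(doi:10.1007/s00453-001-0072-0) beat Ryser by
tabulation, so RyserOptimalDepth3 predicts that table look-up beats algebra at the fine-grained
level. What it does that neighbours do
not: route Depth4 works at product-depth 2 with homogeneous models and shifted partials (its thesis
implies ours: product-depth-1
bounds are logically weaker yet still sufficient over ℂ); route ChowBorderDepth3 shares target,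
chasm and assembly but attacks the
BORDER/padded strengthening, where Kumar's universality (doi:10.1145/3371506: border top fan-in 2
suffices) forces smoothability
arguments; this route stays exact and charges degree through wires, so that universality does not
bite, and it files the only two
rungs of the dial that can be closed now.

RANKED CRUXES. #0 Depth3Thesis (target) — for every c some n admits no product-depth-≤1 circuit over
ℂ computing per_n with at most (n+2)^(c⌊√n⌋+c) wires (shared verbatim with route ChowBorderDepth3;
card Rung 3). (why it might fail: false if per_n has ΣΠΣ circuits with (n+2)^O(√n) wires, as det_n
does (Tavenas2015 p.3); a wire measure proving it must be unsaturated at per vs det; only n^Ω(√log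
n) is known for per_n over ℂ (LST21 via IMM).) [GuptaKamathKayalSaptharishi2016, Tavenas2015,
LimayeSrinivasanTavenas2021, Landsberg2017]
#2 Depth3Chasm (crux) — the depth-3 chasm in the tree's model, filed FIRST because it is the one
unvendored fact the assembly needs (shared verbatim with route ChowBorderDepth3): every VP family f
over ℂ has, for some c and all n, a product-depth-≤1 circuit computing f_n with at most
(n+2)^(c⌊√(deg f_n)⌋+c) wires — GKKS 2016 Thm 1.1 as sharpened by Tavenas 2015 Cor 1 (ΣΠΣ size
2^(O(√(d·log N·log s))), read on arXiv:1304.5777 p.5), specialised to p-bounded N, s, d.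
[difficulty: L] (why it might fail: transcription only: needs Tavenas Cor 1 (2^O(√(d log N log s)));
GKKS Thm 1.1 alone has an extra √(log d) and does not fit (n+2)^(c√d+c); wires not gates; Fischer
identity, duality trick and univariate splitting must be re-run for complex constants.)
[GuptaKamathKayalSaptharishi2016, Tavenas2015, arXiv:1304.5777, doi:10.1007/s00037-016-0132-0]
#3 RyserOptimalDepth3 (crux) — Ryser is optimal at depth three up to poly(n) (card's Ryser
Hypothesis restricted to depth 3; fine-grained form of Rung 3): there is c such that for all n ≥ 1
every expression per_n = Σ_{i<r} Π_{j<D} ℓ_ij with affine ℓ_ij ∈ ℂ[x] (total degree ≤ 1) has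
r·(D+1)·(n+2)^c ≥ 2^n. Ryser/Glynn give r = 2^n − 1 resp. 2^(n−1) with D = n; the statement forbids
trading summands for degree beyond polynomial factors, hence gives ν^{ΠΣ}(per_n) ≥ n − O(log n) for
poly-degree integrands and, via RyserToThesis, the thesis. [difficulty: open-problem] (why it might
fail: inhomogeneity buys exponential factors elsewhere: e_n needs 2^Ω(n) homogeneous summands but
O(n²) wires with degree-2n products (NW/Ben-Or); a per-analogue with 2^(n−ω(log n)) wires refutes it
(cf. Björklund's Boolean 2^(n−Ω(√(n/log n)))); flattenings certify it only for D ≲ 3n.) [Glynn2010,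
NisanWigderson1996, arXiv:1211.0391, doi:10.1007/s00453-001-0072-0, doi:10.1007/pl00001609,
doi:10.1007/s00037-016-0132-0]
#4 ExpSqrtDepth3 (crux) — the first exponential rung strictly below the chasm: there are c > 0 and
n₀ such that for n ≥ n₀ every affine ΣΠΣ expression per_n = Σ_{i<r} Π_{j<D} ℓ_ij over ℂ has r·(D+1)
≥ 2^(⌊√n⌋/c). Its threshold lies below det_n's (n+2)^(O(√n)) wire count, so VP-saturated (per = det
blind) measures are still admissible here, unlike at the thesis. [difficulty: open-problem] (why it
might fail: false iff per_n has ΣΠΣ expressions with 2^o(√n) wires infinitely often; nothing known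
forbids it: over ℂ the record for per_n is n^Ω(√log n) (LST21 via IMM); exponential bounds need
bottom fan-in ≤ N^μ (Kayal–Saha Thm 1.1) or a finite field (Grigoriev–Razborov).)
[LimayeSrinivasanTavenas2021, doi:10.1007/s00037-016-0132-0, GuptaKamathKayalSaptharishi2016,
NisanWigderson1996]
#9 SPSNormalForm (support) — glue (shared verbatim with route ChowBorderDepth3): a product-depth-≤1
circuit with E wires computing per_n gives per_n = Σ_{i≤E} Π_{j≤E} ℓ_ij with affine ℓ_ij over ℂ
(depth-0 gates compute affine forms; forward references evaluate to 0; pad with factors 1 and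
summands 0). [difficulty: provable-now] [LimayeSrinivasanTavenas2021, Burgisser2000]
#9 RyserToThesis (support) — glue: RyserOptimalDepth3 and SPSNormalForm imply Depth3Thesis — a
circuit with E ≤ (n+2)^(c'⌊√n⌋+c') wires yields r(D+1) = (E+1)(E+2), and 2^n > (E+1)(E+2)(n+2)^c for
all large n (elementary growth comparison 2^n vs 2^(O(√n log n))). [difficulty: provable-now]
[Glynn2010, Tavenas2015]
#9 GateCountSuffices (support) — glue to the tree's measure: if for every c some n has
productDepthCircuitSize 1 (per_n) > (n+2)^(c⌊√n⌋+c) (GATES counted,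
`Literature.Computability.AlgebraicComplexity.productDepthCircuitSize`, the currency of the tree's
LST development `LowDepthRankBound`), then Depth3Thesis (wires) holds: normalise a low-wire circuit
through SPSNormalForm-type expansion and rebuild a circuit with ≤ (E+1)²(n²+2)+1 gates. [difficulty:
provable-now] [LimayeSrinivasanTavenas2021, Tavenas2015]
#9 HomogeneousRung (support) — the homogeneous rung of the dial (card Rung 2; NisanWigderson1996,
Landsberg2017 Prop 7.2.2.1 and Ex 6.2.2.7, exact constant): for n ≥ 1, if per_n = Σ_{i<r} Π_{j<n}
ℓ_ij with affine ℓ_ij (exactly n factors), then r ≥ C(n,⌊n/2⌋). Proof route: top-degree parts reduce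
to linear forms; k-th order partials of a product of n linear forms span ≤ C(n,k) dimensions, those
of per_n span C(n,k)² (tree, PROVED:
`Literature.Barriers.ValiantsHypothesis.flatteningRank_perPoly`); subadditivity at k = ⌊n/2⌋. Tight
up to √(πn/2) against Glynn's 2^(n−1). [difficulty: provable-now] [NisanWigderson1996,
Landsberg2017, Glynn2010]
#9 PositiveWitnessBound (support) — Theorem A of the card, upper bound (new; calibrates the positive
rung ν⁺(per_n) ≥ n log₂n − n log₂log₂n − O(n)): for every c there is C such that every g ∈ ℝ≥0[x]
with a Jerrum–Snir monotone computation of size ≤ n^c + c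
(`Literature.Barriers.ValiantsHypothesis.IsMonotoneComputation`) and supp g ⊆ supp per_n (monomials
= permutation matrices) has |supp g| ≤ 2^(n·log₂log₂n + C·n). Proof route: homogenise once; useful
gates compute perfect-matching polynomials on fixed row/column sets (no cancellation over ℝ≥0);
frontier identity g = Σ_u [g:u]·[u] with deg u ∈ [n/3, 2n/3] (tree, PROVED:
`Literature.Computability.AlgebraicComplexity.ArithCircuit.exists_balanced_decomposition`),
quotients [g:u] by the (value, y-coefficient) pair construction (size ×3, homogeneity kept); recurse
to pieces of degree ≤ log₂ n: ≤ 3n/log₂n internal nodes each costing log₂(size) = O(log n), leaves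
cost Σ k·log₂log₂n. [difficulty: provable-now] [JerrumSnir1982,
ChattopadhyayDattaGhosalMukhopadhyay2022, arXiv:1502.01865, ValiantSkyumBerkowitzRackoff1983]
#9 PositiveWitnessConstruction (support) — Theorem A, matching construction (ν⁺(per_n) ≤ n log₂n − n
log₂log₂n + O(n)): there is C such that for every n ≥ 4 some g with a monotone computation of size ≤
n^C + C and supp g ⊆ supp per_n has |supp g| ≥ 2^(n·log₂log₂n − C·n). Witness: cut the rows into
blocks of k = ⌊log₂ n⌋, fix an ordered partition of the columns into blocks of the same sizes, g =
product of the block permanents, each computed by the Jerrum–Snir Laplace-expansion circuit (k·2^k ≤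
n log₂ n gates, shared sub-permanents over column subsets); |supp g| = Π (k_b)! ≥ (k!)^⌊n/k⌋.
[difficulty: provable-now] [JerrumSnir1982, Glynn2010]
#9 HubPerNotVp (support) — hub lemma shared by all permanent-based routes (=
stmt-ValiantsHypothesis-0317, PROVED in Theorems/HubHub.lean): per ∉ VP as an IsVPFamily statement,
the renaming bridge and per ∈ VNP give VP ℂ ≠ VNP ℂ. [difficulty: provable-now] [Valiant1979,
Burgisser2000]

TWO-LAYER PLAN. Foreseen glued splits, filed only when something closes: RyserOptimalDepth3 ⇐
BoundedDegreeRyser (D ≤ 3n: flattenings give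
r ≥ 4^n/(n·C(D,⌊n/2⌋)) = 2^(Ω(n)), provable now) → InterpolationRegime (D > 3n: the Ben-Or regime,
the real crux) → RyserOptimalDepth3;
ExpSqrtDepth3 ⇐ bottom-fan-in-restricted case (Kayal–Saha Thm 1.1 transferred to per_n by
projection) → general affine forms → ExpSqrtDepth3;
PositiveWitnessBound ⇐ QuotientCircuits (monotone homogeneous circuits of size 3s for gate
quotients) → RecursionCount → PositiveWitnessBound.

KILL CRITERIA. An affine ΣΠΣ expression of per_n with r(D+1) = 2^(n−ω(log n)) wires refutes
RyserOptimalDepth3: the card's fine-grained thesis dies and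
the route pivots to ExpSqrtDepth3/Depth3Thesis only if the witness is not scalable; one with
2^(o(√n)) wires refutes ExpSqrtDepth3 as well;
one with (n+2)^(O(√n)) wires (a GKKS duality-trick circuit transplanted from det to per) refutes
Depth3Thesis and closes this route AND
ChowBorderDepth3 (`close --reason refuted:Depth3Thesis`). A monotone poly-size g ⊆ supp per_n with
more than 2^(n log₂log₂n + ω(n))
monomials refutes PositiveWitnessBound (Theorem A) without touching the line. Depth4Thesis,
ChowBorderBound or any other proof of per ∉ VP
moots the route (Depth4Thesis ⇒ gate form ⇒ Depth3Thesis).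

NOT DECOMPOSED YET. The degree split of RyserOptimalDepth3 (D ≤ 3n by flattenings vs the
interpolation regime) and its "bits" form (r alone ≥ 2^n/poly for
every D) — deliberately not filed: Kumar's border universality (doi:10.1145/3371506, border top
fan-in 2 for every form) shows that no
border-closed measure bounds r without charging D; the per/HC/haf base-preserving reductions and the
HC alternating-product identity of the
card (Literature lemma candidates, not items); a shared definition of ν_G; the VP-integrand rung (=
the summit itself).

CHEAPEST FALSIFIER. Computer algebra at n = 3, 4 (kit, Gröbner/numerical homotopy on the bilinear
systems): the minimal r with per_n = Σ_{i<r} Π_{j<D} ℓ_ij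
over ℚ and over ℂ for D = n, n+1, …, 2n. Calibration: Glynn gives r = 4, 8 at D = n; HomogeneousRung
forces r ≥ 3, 6 at D = n. An r that
DROPS as D grows past n (say per_4 with r ≤ 5 at D = 8) is the Ben-Or signature that would sink
RyserOptimalDepth3 and is cheap to look
for; no drop up to D = 2n supports it. Lookup done at filing: no sub-Ryser algebraic depth-3 formula
for per_n in the searched literature
(doi:10.1007/s00037-016-0132-0 p.2: "the best known circuit for computing the permanent … is Ryser's
formula").

NUMBERS. Chasm: VP ⇒ ΣΠΣ size 2^(O(√(d log N log s))) (Tavenas2015 Cor 1; GKKS Thm 1.1 had 2^(O(√(d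
log N log s log d)))) = (n+2)^(O(√d)) wires
for p-families; det_n: 2^(O(√n log n)) (arXiv:1304.5777 p.3). Dial for per_n (summands r at degree
D): n! (D = n, monomials);
positive: 2^(n log₂log₂n ± O(n)) (Theorem A; Jerrum–Snir exact monotone ⊗-count n(2^(n−1) − 1));
homogeneous D = n: C(n,⌊n/2⌋) ≤ r ≤ 2^(n−1)
(flattenings C(n,k)²/C(n,k); Glynn2010; Landsberg2017 Prop 7.2.2.1 prints 2^n/n); Ryser r = 2^n − 1.
Known lower bounds for unrestricted
ΣΠΣ over ℂ: quadratic/polynomial (doi:10.1007/pl00001609), superpolynomial n^(Ω(√log n)) via IMM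
(LimayeSrinivasanTavenas2021); with
bottom fan-in τ: top fan-in N^(Ω(d/τ)) for a VP family, i.e. the chasm is saturated at τ = √d
(doi:10.1007/s00037-016-0132-0 Thm 1.1);
e_n on 2n variables: 2^(Ω(n)) homogeneous vs O(n²) with bottom fan-in 2 (ibid. p.3, after
Nisan–Wigderson); finite fields: 2^(Ω(n))
(Grigoriev–Razborov 2000). Boolean foil: 0/1 permanents in 2^(n−Ω(√(n/log n))) expected time
(arXiv:1211.0391), 2^(n−Ω(n^(1/3)/ln n))
(doi:10.1007/s00453-001-0072-0). Border: top fan-in 2 is universal with D = exp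
(doi:10.1145/3371506). Items at open: 12 (target,
3 cruxes, 7 support, assembly); 5 of them shared verbatim with ChowBorderDepth3 / the hub.

DEFINITION REQUESTS. None blocking. ν_G (summation bits over an integrand class G) is deliberately
NOT requested: every item inlines its expression class
(r, D, ℓ with totalDegree ≤ 1, the convention of route ChowBorderDepth3), and the monotone rung uses
the catalogued
`Literature.Barriers.ValiantsHypothesis.IsMonotoneComputation`. If a grounder prefers, a definition
`affineSPSWires n r D` under
Summits/ValiantsHypothesis/ValiantsHypothesis/Theorems can replace the inlined blocks later.

Novelty: Searches (2026-08-15): `lit search "arithmetic circuits chasm at depth three"` (local 12 docs; READ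
arXiv:1304.5777 pp.3,5 — Prop 1 =
GKKS Thm 1.1, Cor 1; READ doi:10.1007/s00037-016-0132-0 pp.1–4,15 — Thm 1.1, Ryser sentence, e_n
contrast; hits also ICALP'16 almost-cubic,
arXiv:1401.0189, doi:10.1137/140957123, doi:10.1007/pl00001609); `lit galaxy search --star all` ×4:
"border of depth-3 arithmetic circuits"
(2 pdf: DDS FOCS'21 full version READ chunks 1–14 → Kumar ToCT'20 universality; arXiv:2311.17019),
"faster than Ryser" (arXiv:1908.03252,
Boolean/symbolic), "Ryser's formula is optimal" (0), "depth three circuit computing the permanent"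
(0); `lean search` for
productDepthCircuitSize 1 / ΣΠΣ / flatteningRank_perPoly / exists_balanced_decomposition (depth-3
chasm not vendored; flattening rank and
monotone balanced decomposition PROVED); the card audit's searches (arXiv:1907.12287 Def 4.15/Thm
6.4 VW[t]; arXiv:1502.01865 Lemma 6, Cor 1);
`ledger negatives` (0). Local searchd was down for part of the session (rc 75) and OpenAlex/S2/arXiv
answered HTTP 429; zbMATH/Crossref worked.
Nearest prior art found: GuptaKamathKayalSaptharishi2016 + Tavenas2015 Cor 1 (the target is their
contrapositive); route ChowBorderDepth3
(same target/chasm/assembly, border mechanism); doi:10.1007/s00037-016-0132-0 Thm 1.1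
(bottom-fan-in-restricted depth 3 saturates the
chasm); NisanWigderson1996 / Landsberg2017 Prop 7.2.2.1 (homogeneous rung); JerrumSnir1982 +
ChattopadhyayDattaGhosalMukhopadhyay  [refs: 10.1007/s00037-016-0132-0, 10.1137/140957123, 10.1007/pl00001609, 10.1145/3371506, 1304.5777, 1401.0189, 2311.17019, 1908.03252, 1907.12287, 1502.01865, 1211.0391, doi:10.1007/s00037-016-0132-0, doi:10.1137/140957123, doi:10.1007/pl00001609, doi:10.1145/3371506, GuptaKamathKayalSaptharishi2016, Tavenas2015, NisanWigderson1996, Landsberg2017, JerrumSnir1982, ChattopadhyayDattaGhosalMukhopadhyay2022]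

Barriers (technique_class: summation-count, depth-three, monotone-support-extremal): - technique_class: summation-count, depth-three, monotone-support-extremal
- Literature.Barriers.ValiantsHypothesis.DepthReductionChasm: its depth-3 analogue applies squarely
to Depth3Thesis — det_n has (n+2)^(O(√n))-wire ΣΠΣ circuits (arXiv:1304.5777 p.3) and
bottom-fan-in-√d depth 3 is saturated by a VP family (doi:10.1007/s00037-016-0132-0 Thm 1.1), so a
wire measure proving X must separate per from det; it does not evade; the bet is split:
ExpSqrtDepth3 sits BELOW det's threshold (saturated measures admissible), RyserOptimalDepth3 sits
above it and needs per-specific (sign / VNP) structure that nothing filed yet supplies.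
- Literature.Barriers.ValiantsHypothesis.DepthReductionChasmDepthFour: same remark one product-layer
up; Depth4Thesis implies our target, not conversely, so this route asks for strictly less than
Depth4.
- Literature.Barriers.ValiantsHypothesis.PartialDerivativesDetPerm: flattening ranks agree on per
and det; used ONLY for HomogeneousRung (tight up to √n there) and the D ≤ 3n regime of
RyserOptimalDepth3; beyond D ≈ 3n the factor C(D,⌊n/2⌋) swamps them — acknowledged: the
interpolation regime needs a degree-sensitive non-rank tool.
- Literature.Barriers.ValiantsHypothesis.MonotoneGap: respected by construction — Theorem A lives
inside the monotone world as calibration of the dial; no monotone→general transfer is claimed (the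
tree refutes it: `MonotoneGap.not_monotoneLowerBoundsTransfer`); SensitiveDiscrepancy likewise
untouched.
- Literature.Barriers.Val

Novelty grade: new-combination — ROUTE REVIEW (refuter rreview b4b00054, 2026-08-15): PRECISE, ELABORATES (tree rev 1), NON-VACUOUS; already batch-stamped by refuters g40-54/g41-51/g41-13/g41-4 with candidate proofs on Assembly (5941) and RyserToThesis (7567). Independent confirmation of the model audit: unbounded fan-in WEIGHTED s (refuter refuter-rreview-route-CriticalPhenomena--b4b00054-0, 2026-08-15T14:04:47Z; prior: GuptaKamathKayalSaptharishi2016, Tavenas2015, doi:10.1007/s00037-016-0132-0, NisanWigderson1996, JerrumSnir1982, Glynn2010, arXiv:1211.0391, doi:10.1145/3371506, route-ValiantsHypothesis-ChowBorderDepth3)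

History (route lifecycle, newest last):
- 2026-08-15T16:17:16Z · rev 2: restated PositiveWitnessBound (stmt-ValiantsHypothesis-7570), PositiveWitnessConstruction (stmt-ValiantsHypothesis-7571) — route-repair (glue + cone): (1) drop import Literature.Barriers.ValiantsHypothesis.MonotoneGap — it was needed only for IsMonotoneComputation in the rank-9 cali (planner-rbadge-ValiantsHypothesis-SummationBit-ea751f29-g2-0)
- 2026-08-16T04:22:05Z · AUTO-CRUX (backfill): Depth3Thesis — hypotheses of the deciding theorem that nothing in the route derives are cruxes (operator:999:1085951)
- 2026-08-26T12:04:54Z · DORMANT — reconciler: no traction for 8.2 d (last activity item-evidence-added at 2026-08-18T06:27:25Z); parked, not closed — `ledger route dormant route-ValiantsHypothes (operator:999:3896958)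

sub-problem: ValiantsHypothesis · status: dormant · opened planner-plancard-ValiantsHypothesis-ValiantsH-5bf29e11-0 2026-08-15T12:12:02Z · rev 2 · ledger route-ValiantsHypothesis-SummationBits
GENERATED by the gate from the ledger (D-0016/17). Provers cite these decls: `theorem foo : Summit.ValiantsHypothesis.ValiantsHypothesis.Theses.SummationBits.<Decl> := …` in Summits/ValiantsHypothesis/ValiantsHypothesis/Theorems/<Name>.lean.
-/

namespace Summit.ValiantsHypothesis.ValiantsHypothesis.Theses.SummationBits

open scoped BigOperators Topology Manifold Classical MeasureTheory ProbabilityTheory Matrix InnerProductSpace ComplexConjugate ContinuousMap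
open Filter Set Function TopologicalSpace MeasureTheory

attribute [summit_statement] _root_.ValiantsHypothesis

open Literature.PNP

/-- item stmt-ValiantsHypothesis-5934 · crux (kind.auto-crux: conjecture-grade) · rank 0 · open · by planner
why it might fail: false if per_n has ΣΠΣ circuits with (n+2)^O(√n) wires, as det_n does (Tavenas2015 p.3); a wire measure proving it must be unsaturated at per vs det; only n^Ω(√log n) is known for per_n over ℂ (LST21 via IMM).
sources: GuptaKamathKayalSaptharishi2016, Tavenas2015, LimayeSrinivasanTavenas2021, Landsberg2017
[target] for every c some n admits no product-depth-≤1 circuit computing per_n over ℂ with at most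
(n+2)^(c⌊√n⌋+c) wires. -/
@[route_item "route-ValiantsHypothesis-SummationBits", crux]
def Depth3Thesis : Prop :=
  ∀ c : ℕ, ∃ n : ℕ, ∀ P : Literature.Computability.AlgebraicComplexity.ArithCircuit ℂ (Fin n × Fin n), P.Computes (Literature.Computability.AlgebraicComplexity.perPoly (Fin n) ℂ) → P.productDepth ≤ 1 → (n + 2) ^ (c * Nat.sqrt n + c) < P.edgeSize

/-- item stmt-ValiantsHypothesis-5935 · crux · rank 2 · closed · proved by Summit.ValiantsHypothesis.ValiantsHypothesis.Theorems.ChowBorderDepth3Depth3Chasm.depth3Chasm_proof @ a57bb1e1b009 (prover) · by planner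
why it might fail: transcription only: needs Tavenas Cor 1 (2^O(√(d log N log s))); GKKS Thm 1.1 alone has an extra √(log d) and does not fit (n+2)^(c√d+c); wires not gates; Fischer identity, duality trick and univariate splitting must be re-run for complex constants.
sources: GuptaKamathKayalSaptharishi2016, Tavenas2015, arXiv:1304.5777, doi:10.1007/s00037-016-0132-0
[crux] depth-3 chasm in the tree's model (unvendored named fact, filed FIRST): every VP family f
over ℂ has, for some c and all n, a product-depth-≤1 circuit computing f_n with at most
(n+2)^(c⌊√(deg f_n)⌋+c) wires (GKKS 2016 Thm 1.1 via Tavenas 2015: ΣΠΣ size 2^(O(√(d log(ds) log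
N)))). [difficulty: L] -/
@[route_item "route-ValiantsHypothesis-SummationBits", crux]
def Depth3Chasm : Prop :=
  ∀ {σ : ℕ → Type} [∀ n, Fintype (σ n)] (f : ∀ n, MvPolynomial (σ n) ℂ), Literature.Computability.AlgebraicComplexity.IsVPFamily f → ∃ c : ℕ, ∀ n : ℕ, ∃ P : Literature.Computability.AlgebraicComplexity.ArithCircuit ℂ (σ n), P.Computes (f n) ∧ P.productDepth ≤ 1 ∧ P.edgeSize ≤ (n + 2) ^ (c * Nat.sqrt ((f n).totalDegree) + c)

/-- `Depth3Chasm` holds: proved by `Summit.ValiantsHypothesis.ValiantsHypothesis.Theorems.ChowBorderDepth3Depth3Chasm.depth3Chasm_proof` @ a57bb1e1b009. -/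
theorem Depth3Chasm_holds : Depth3Chasm := _root_.Summit.ValiantsHypothesis.ValiantsHypothesis.Theorems.ChowBorderDepth3Depth3Chasm.depth3Chasm_proof

/-- item stmt-ValiantsHypothesis-7565 · crux · rank 3 · open · by planner
why it might fail: inhomogeneity buys exponential factors elsewhere: e_n needs 2^Ω(n) homogeneous summands but O(n²) wires with degree-2n products (NW/Ben-Or); a per-analogue with 2^(n−ω(log n)) wires refutes it (cf. Björklund's Boolean 2^(n−Ω(√(n/log n)))); flattenings certify only D ≤ 2.9n.
sources: Glynn2010, NisanWigderson1996, arXiv:1211.0391, doi:10.1007/s00453-001-0072-0, doi:10.1007/pl00001609, doi:10.1007/s00037-016-0132-0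
[crux] Ryser is optimal at depth three up to poly(n) (card's Ryser Hypothesis restricted to depth 3;
fine-grained form of Rung 3): there is c such that for all n ≥ 1 every expression per_n = Σ_{i<r}
Π_{j<D} ℓ_ij with affine ℓ_ij ∈ ℂ[x] (total degree ≤ 1) has r·(D+1)·(n+2)^c ≥ 2^n. Ryser/Glynn give
r = 2^n − 1 resp. 2^(n−1) with D = n; the statement forbids trading summands for degree beyond
polynomial factors, hence gives ν^{ΠΣ}(per_n) ≥ n − O(log n) for poly-degree integrands and, via
RyserToThesis, the thesis. [difficulty: open-problem] -/
@[route_item "route-ValiantsHypothesis-SummationBits", crux]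
def RyserOptimalDepth3 : Prop :=
  ∃ c : ℕ, ∀ n : ℕ, 1 ≤ n → ∀ (r D : ℕ) (ℓ : Fin r → Fin D → MvPolynomial (Fin n × Fin n) ℂ), (∀ i j, (ℓ i j).totalDegree ≤ 1) → (∑ i, ∏ j, ℓ i j) = Literature.Computability.AlgebraicComplexity.perPoly (Fin n) ℂ → 2 ^ n ≤ r * (D + 1) * (n + 2) ^ c

/-- item stmt-ValiantsHypothesis-7566 · crux · rank 4 · open · by planner
why it might fail: false iff per_n has ΣΠΣ expressions with 2^o(√n) wires infinitely often; nothing known forbids it: over ℂ the record for per_n is n^Ω(√log n) (LST21 via IMM); exponential bounds need bottom fan-in ≤ N^μ (Kayal–Saha Thm 1.1) or a finite field (Grigoriev–Razborov).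
sources: LimayeSrinivasanTavenas2021, doi:10.1007/s00037-016-0132-0, GuptaKamathKayalSaptharishi2016, NisanWigderson1996
[crux] the first exponential rung strictly below the chasm: there are c > 0 and n₀ such that for n ≥
n₀ every affine ΣΠΣ expression per_n = Σ_{i<r} Π_{j<D} ℓ_ij over ℂ has r·(D+1) ≥ 2^(⌊√n⌋/c). Its
threshold lies below det_n's (n+2)^(O(√n)) wire count, so VP-saturated (per = det blind) measures
are still admissible here, unlike at the thesis. [difficulty: open-problem] -/
@[route_item "route-ValiantsHypothesis-SummationBits", crux]
def ExpSqrtDepth3 : Prop :=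
  ∃ c : ℕ, 0 < c ∧ ∃ n₀ : ℕ, ∀ n ≥ n₀, ∀ (r D : ℕ) (ℓ : Fin r → Fin D → MvPolynomial (Fin n × Fin n) ℂ), (∀ i j, (ℓ i j).totalDegree ≤ 1) → (∑ i, ∏ j, ℓ i j) = Literature.Computability.AlgebraicComplexity.perPoly (Fin n) ℂ → 2 ^ (Nat.sqrt n / c) ≤ r * (D + 1)

/-- item stmt-ValiantsHypothesis-0317 · support · rank 9 · closed · proved by Summit.ValiantsHypothesis.ValiantsHypothesis.Theorems.hubPerNotVp_proof @ 99b2d3f5f142 (prover) · by planner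
sources: Valiant1979, Burgisser2000
Hub lemma shared by all permanent-based routes: if the permanent family over ℂ is not a VP family
then VP ℂ ≠ VNP ℂ, given the renaming bridge (mem_VP_ofFintype_iff instance) and per ∈ VNP
[Valiant1979; Burgisser2000 Thm 2.10]. Trivial bookkeeping; land once in
Summits/ValiantsHypothesis/Theorems/Hub/. -/
@[route_item "route-ValiantsHypothesis-SummationBits", crux]
def HubPerNotVp : Prop :=
  ¬ Literature.Computability.AlgebraicComplexity.IsVPFamily (fun n => Literature.Computability.AlgebraicComplexity.perPoly (Fin n) ℂ) → (Literature.Computability.AlgebraicComplexity.perFamily ℂ ∈ Literature.Computability.AlgebraicComplexity.VP ℂ ↔ Literature.Computability.AlgebraicComplexity.IsVPFamily (fun n => Literature.Computability.AlgebraicComplexity.perPoly (Fin n) ℂ)) → Literature.Computability.AlgebraicComplexity.perFamily_mem_VNP ℂ → ValiantsHypothesis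

/-- `HubPerNotVp` holds: proved by `Summit.ValiantsHypothesis.ValiantsHypothesis.Theorems.hubPerNotVp_proof` @ 99b2d3f5f142. -/
theorem HubPerNotVp_holds : HubPerNotVp := _root_.Summit.ValiantsHypothesis.ValiantsHypothesis.Theorems.hubPerNotVp_proof

-- earlier PositiveWitnessBound (stmt-ValiantsHypothesis-7570, replaced 2026-08-15T16:17:16Z -> stmt-ValiantsHypothesis-10488): retired by None — ∀ c : ℕ, ∃ C : ℕ, ∀ (n : ℕ) (P : Literature.Computability.AlgebraicComplexity.ArithCircuit NNReal (Fin n × Fin n)) (g : MvPolynomial (Fin n × Fin n) NNReal), Literature.Barriers.ValiantsHypothesis.IsMonotoneComputation P g → P.size ≤ n ^ c + c → g.support ⊆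
/-- item stmt-ValiantsHypothesis-10488 · support · rank 9 · closed · proved by Summit.ValiantsHypothesis.ValiantsHypothesis.Theorems.positiveWitnessBound_proof (prover) · by planner
sources: JerrumSnir1982, ChattopadhyayDattaGhosalMukhopadhyay2022, arXiv:1502.01865, ValiantSkyumBerkowitzRackoff1983
[support] Theorem A of the card, upper bound (new; calibrates the positive rung ν⁺(per_n) ≥ n log₂n
− n log₂log₂n − O(n)): for every c there is C such that every g ∈ ℝ≥0[x] with a Jerrum–Snir monotone
computation P of size ≤ n^c + c — fan-in two, every sum gate with all coefficients 1, P computes g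
(this is `IsMonotoneComputation` of Literature/Barriers/ValiantsHypothesis/MonotoneGap.lean written
out, so that the route no longer imports that barrier file; equivalence Lean-checked) — and supp g ⊆
supp per_n (monomials = permutation matrices) has |supp g| ≤ 2^(n·log₂log₂n + C·n). Proof route:
homogenise once; useful gates compute perfect-matching polynomials on fixed row/column sets (no
cancellation over ℝ≥0); frontier identity g = Σ_u [g:u]·[u] with deg u ∈ [n/3, 2n/3] (tree, PROVED:
`Literature.Computability.AlgebraicComplexity.ArithCircuit.exists_balanced_decomposition`),
quotients [g:u] by the (value, y-coefficient) pair construction (size ×3, homogeneity kept); recurse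
to pieces of degree ≤ log₂ n: ≤ 3n/log₂n internal nodes each costing log₂(size) = O(log n), leaves
cost Σ k·log₂log₂n. [difficulty: provable-now] -/
@[route_item "route-ValiantsHypothesis-SummationBits", crux]
def PositiveWitnessBound : Prop :=
  ∀ c : ℕ, ∃ C : ℕ, ∀ (n : ℕ) (P : Literature.Computability.AlgebraicComplexity.ArithCircuit NNReal (Fin n × Fin n)) (g : MvPolynomial (Fin n × Fin n) NNReal), (P.IsFanInTwo ∧ (∀ args, Literature.Computability.AlgebraicComplexity.ArithCircuit.Gate.sum args ∈ P.gates → ∀ a ∈ args, a.1 = (1 : NNReal)) ∧ P.Computes g) → P.size ≤ n ^ c + c → g.support ⊆ (Literature.Computability.AlgebraicComplexity.perPoly (Fin n) NNReal).support → (g.support.card : ℝ) ≤ (2 : ℝ) ^ ((n : ℝ) * Real.logb 2 (Real.logb 2 (n : ℝ)) + (C : ℝ) * n)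

-- `PositiveWitnessBound` holds: proved by `Summit.ValiantsHypothesis.ValiantsHypothesis.Theorems.positiveWitnessBound_proof` (its module imports this route file, so no `_holds` link can be stated here).

-- earlier PositiveWitnessConstruction (stmt-ValiantsHypothesis-7571, replaced 2026-08-15T16:17:16Z -> stmt-ValiantsHypothesis-10489): retired by None — ∃ C : ℕ, ∀ n : ℕ, 4 ≤ n → ∃ (P : Literature.Computability.AlgebraicComplexity.ArithCircuit NNReal (Fin n × Fin n)) (g : MvPolynomial (Fin n × Fin n) NNReal), Literature.Barriers.ValiantsHypothesis.IsMonotoneComputation P g ∧ P.size ≤ n ^ C + C ∧ g.su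
/-- item stmt-ValiantsHypothesis-10489 · support · rank 9 · closed · proved by Summit.ValiantsHypothesis.Theorems.SummationBits.PositiveWitnessConstruction_proof @ 1ea7761eac82 (prover) · by planner
sources: JerrumSnir1982, Glynn2010
[support] Theorem A, matching construction (ν⁺(per_n) ≤ n log₂n − n log₂log₂n + O(n)): there is C
such that for every n ≥ 4 some g with a Jerrum–Snir monotone computation (fan-in two, all sum
coefficients 1 — `IsMonotoneComputation` written out) of size ≤ n^C + C and supp g ⊆ supp per_n has
|supp g| ≥ 2^(n·log₂log₂n − C·n). Witness: cut the rows into blocks of k = ⌊log₂ n⌋, fix an ordered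
partition of the columns into blocks of the same sizes, g = product of the block permanents, each
computed by the Jerrum–Snir Laplace-expansion circuit (k·2^k ≤ n log₂ n gates, shared sub-permanents
over column subsets); |supp g| = Π (k_b)! ≥ (k!)^⌊n/k⌋. [difficulty: provable-now] -/
@[route_item "route-ValiantsHypothesis-SummationBits", crux]
def PositiveWitnessConstruction : Prop :=
  ∃ C : ℕ, ∀ n : ℕ, 4 ≤ n → ∃ (P : Literature.Computability.AlgebraicComplexity.ArithCircuit NNReal (Fin n × Fin n)) (g : MvPolynomial (Fin n × Fin n) NNReal), (P.IsFanInTwo ∧ (∀ args, Literature.Computability.AlgebraicComplexity.ArithCircuit.Gate.sum args ∈ P.gates → ∀ a ∈ args, a.1 = (1 : NNReal)) ∧ P.Computes g) ∧ P.size ≤ n ^ C + C ∧ g.support ⊆ (Literature.Computability.AlgebraicComplexity.perPoly (Fin n) NNReal).support ∧ (2 : ℝ) ^ ((n : ℝ) * Real.logb 2 (Real.logb 2 (n : ℝ)) - (C : ℝ) * n) ≤ (g.support.card : ℝ)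

-- `PositiveWitnessConstruction` holds: proved by `Summit.ValiantsHypothesis.Theorems.SummationBits.PositiveWitnessConstruction_proof` @ 1ea7761eac82 (its module imports this route file, so no `_holds` link can be stated here).

/-- item stmt-ValiantsHypothesis-5939 · support · rank 9 · closed · proved by Summit.ValiantsHypothesis.ValiantsHypothesis.Theorems.SPSNormalForm_proof @ 34198bccdf3d (prover) · by planner
sources: LimayeSrinivasanTavenas2021, Burgisser2000
[support] glue: a product-depth-≤1 circuit with E wires computing per_n gives per_n = Σ_{i≤E}
Π_{j≤E} ℓ_ij with affine ℓ_ij over ℂ (depth-0 gates compute affine forms; forward references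
evaluate to 0; pad with factors 1 and summands 0). [difficulty: provable-now] -/
@[route_item "route-ValiantsHypothesis-SummationBits", crux]
def SPSNormalForm : Prop :=
  ∀ (n : ℕ) (P : Literature.Computability.AlgebraicComplexity.ArithCircuit ℂ (Fin n × Fin n)), P.Computes (Literature.Computability.AlgebraicComplexity.perPoly (Fin n) ℂ) → P.productDepth ≤ 1 → ∃ (ℓ : Fin (P.edgeSize + 1) → Fin (P.edgeSize + 1) → MvPolynomial (Fin n × Fin n) ℂ), (∀ i j, (ℓ i j).totalDegree ≤ 1) ∧ (∑ i, ∏ j, ℓ i j) = Literature.Computability.AlgebraicComplexity.perPoly (Fin n) ℂ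

/-- `SPSNormalForm` holds: proved by `Summit.ValiantsHypothesis.ValiantsHypothesis.Theorems.SPSNormalForm_proof` @ 34198bccdf3d. -/
theorem SPSNormalForm_holds : SPSNormalForm := _root_.Summit.ValiantsHypothesis.ValiantsHypothesis.Theorems.SPSNormalForm_proof

/-- item stmt-ValiantsHypothesis-7567 · support · rank 9 · closed · proved by Summit.ValiantsHypothesis.ValiantsHypothesis.Theorems.ryserToThesis_proof @ 28ec1a0d4178 (prover) · by planner
sources: Glynn2010, Tavenas2015
[support] glue: RyserOptimalDepth3 and SPSNormalForm imply Depth3Thesis — a circuit with E ≤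
(n+2)^(c'⌊√n⌋+c') wires yields r(D+1) = (E+1)(E+2), and 2^n > (E+1)(E+2)(n+2)^c for all large n
(elementary growth comparison 2^n vs 2^(O(√n log n))). [difficulty: provable-now] -/
@[route_item "route-ValiantsHypothesis-SummationBits", crux]
def RyserToThesis : Prop :=
  RyserOptimalDepth3 → SPSNormalForm → Depth3Thesis

-- `RyserToThesis` holds: proved by `Summit.ValiantsHypothesis.ValiantsHypothesis.Theorems.ryserToThesis_proof` @ 28ec1a0d4178 (its module imports this route file, so no `_holds` link can be stated here).

/-- item stmt-ValiantsHypothesis-7568 · support · rank 9 · closed · proved by Summit.ValiantsHypothesis.ValiantsHypothesis.Theorems.SummationBitsGateCountSuffices.gateCountSuffices_proof (prover) · by planner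
sources: LimayeSrinivasanTavenas2021, Tavenas2015
[support] glue to the tree's measure: if for every c some n has productDepthCircuitSize 1 (per_n) >
(n+2)^(c⌊√n⌋+c) (GATES counted,
`Literature.Computability.AlgebraicComplexity.productDepthCircuitSize`, the currency of the tree's
LST development `LowDepthRankBound`), then Depth3Thesis (wires) holds: normalise a low-wire circuit
through SPSNormalForm-type expansion and rebuild a circuit with ≤ (E+1)²(n²+2)+1 gates. [difficulty:
provable-now] -/
@[route_item "route-ValiantsHypothesis-SummationBits", crux]
def GateCountSuffices : Prop :=
  (∀ c : ℕ, ∃ n : ℕ, ((n + 2 : ℕ∞) ^ (c * Nat.sqrt n + c)) < Literature.Computability.AlgebraicComplexity.productDepthCircuitSize 1 (Literature.Computability.AlgebraicComplexity.perPoly (Fin n) ℂ)) → Depth3Thesis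

-- `GateCountSuffices` holds: proved by `Summit.ValiantsHypothesis.ValiantsHypothesis.Theorems.SummationBitsGateCountSuffices.gateCountSuffices_proof` (its module imports this route file, so no `_holds` link can be stated here).

/-- item stmt-ValiantsHypothesis-7569 · support · rank 9 · closed · proved by Summit.ValiantsHypothesis.SummationBits.homogeneousRung_proof (prover) · by planner
sources: NisanWigderson1996, Landsberg2017, Glynn2010
[support] the homogeneous rung of the dial (card Rung 2; NisanWigderson1996, Landsberg2017 Prop
7.2.2.1 and Ex 6.2.2.7, exact constant): for n ≥ 1, if per_n = Σ_{i<r} Π_{j<n} ℓ_ij with affine ℓ_ij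
(exactly n factors), then r ≥ C(n,⌊n/2⌋). Proof route: top-degree parts reduce to linear forms; k-th
order partials of a product of n linear forms span ≤ C(n,k) dimensions, those of per_n span C(n,k)²
(tree, PROVED: `Literature.Barriers.ValiantsHypothesis.flatteningRank_perPoly`); subadditivity at k
= ⌊n/2⌋. Tight up to √(πn/2) against Glynn's 2^(n−1). [difficulty: provable-now] -/
@[route_item "route-ValiantsHypothesis-SummationBits", crux]
def HomogeneousRung : Prop :=
  ∀ n : ℕ, 1 ≤ n → ∀ (r : ℕ) (ℓ : Fin r → Fin n → MvPolynomial (Fin n × Fin n) ℂ), (∀ i j, (ℓ i j).totalDegree ≤ 1) → (∑ i, ∏ j, ℓ i j) = Literature.Computability.AlgebraicComplexity.perPoly (Fin n) ℂ → n.choose (n / 2) ≤ r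

-- `HomogeneousRung` holds: proved by `Summit.ValiantsHypothesis.SummationBits.homogeneousRung_proof` (its module imports this route file, so no `_holds` link can be stated here).

/-- item stmt-ValiantsHypothesis-5941 · assembly · rank 1 · closed · proved by Summit.ValiantsHypothesis.ValiantsHypothesis.Theorems.chowBorderDepth3_assembly_proof (prover) · by planner
sources: GuptaKamathKayalSaptharishi2016, Tavenas2015, Valiant1979, Burgisser2000
[assembly] Depth3Chasm → Depth3Thesis → (deg per_n = n) → (perFamily ∈ VP ↔ IsVPFamily per) → per ∈
VNP → ValiantsHypothesis. -/
@[route_item "route-ValiantsHypothesis-SummationBits", crux]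
def Assembly : Prop :=
  Depth3Chasm → Depth3Thesis → (∀ n : ℕ, (Literature.Computability.AlgebraicComplexity.perPoly (Fin n) ℂ).totalDegree = n) → (Literature.Computability.AlgebraicComplexity.perFamily ℂ ∈ Literature.Computability.AlgebraicComplexity.VP ℂ ↔ Literature.Computability.AlgebraicComplexity.IsVPFamily (fun n => Literature.Computability.AlgebraicComplexity.perPoly (Fin n) ℂ)) → Literature.Computability.AlgebraicComplexity.perFamily_mem_VNP ℂ → ValiantsHypothesis

/-- `Assembly` holds: proved by `Summit.ValiantsHypothesis.ValiantsHypothesis.Theorems.chowBorderDepth3_assembly_proof`. -/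
theorem Assembly_holds : Assembly := _root_.Summit.ValiantsHypothesis.ValiantsHypothesis.Theorems.chowBorderDepth3_assembly_proof

/-! D-0027 §2.1 — DECIDING THEOREM (planner-authored via `route open/edit --closes-file`; by planner-rbadge-ValiantsHypothesis-SummationBit-ea751f29-g2-0 2026-08-15T16:17:16Z):
its hypotheses are this route's items and its conclusion the sub-problem Statement (glue_lint), and it elaborates with this file. -/

@[closes "route-ValiantsHypothesis-SummationBits"] theorem closes : Depth3Thesis → Depth3Chasm → RyserOptimalDepth3 → ExpSqrtDepth3 → HubPerNotVp → SPSNormalForm → RyserToThesis → GateCountSuffices → HomogeneousRung → PositiveWitnessBound → PositiveWitnessConstruction → Assembly → _root_.ValiantsHypothesis := by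
  intro h_Depth3Thesis h_Depth3Chasm _h_RyserOptimalDepth3 _h_ExpSqrtDepth3 _h_HubPerNotVp _h_SPSNormalForm _h_RyserToThesis _h_GateCountSuffices _h_HomogeneousRung _h_PositiveWitnessBound _h_PositiveWitnessConstruction _h_Assembly
  -- VP ℂ ≠ VNP ℂ: suppose equality
  show Literature.Computability.AlgebraicComplexity.VP ℂ ≠ Literature.Computability.AlgebraicComplexity.VNP ℂ
  intro hEq
  -- per ∈ VNP = VP (Valiant 1979, tree theorem `perFamily_mem_VNP_holds`), so the permanent is a VP family
  -- (renaming bridge, tree theorem `mem_VP_ofFintype_iff_holds`)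
  have hVNP := Literature.Computability.AlgebraicComplexity.perFamily_mem_VNP_holds ℂ
  have hVP : Literature.Computability.AlgebraicComplexity.perFamily ℂ ∈
      Literature.Computability.AlgebraicComplexity.VP ℂ := by rw [hEq]; exact hVNP
  have hfam : Literature.Computability.AlgebraicComplexity.IsVPFamily
      (fun n => Literature.Computability.AlgebraicComplexity.perPoly (Fin n) ℂ) :=
    (Literature.Computability.AlgebraicComplexity.mem_VP_ofFintype_iff_holds _).1 hVP
  -- the depth-3 chasm (crux Depth3Chasm) gives one `c` and, for every `n`, a product-depth-≤1 circuit
  -- for per_n with at most (n+2)^(c·⌊√(deg per_n)⌋+c) wires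
  obtain ⟨c, hc⟩ := h_Depth3Chasm (σ := fun n => Fin n × Fin n)
    (fun n => Literature.Computability.AlgebraicComplexity.perPoly (Fin n) ℂ) hfam
  -- the thesis (target Depth3Thesis) refuses that `c` at some `n`
  obtain ⟨n, hn⟩ := h_Depth3Thesis c
  obtain ⟨P, hP, hd, he⟩ := hc n
  -- deg per_n = n (tree theorem `totalDegree_perPoly_holds`)
  have hdeg : (Literature.Computability.AlgebraicComplexity.perPoly (Fin n) ℂ).totalDegree = n := by
    rw [Literature.Computability.AlgebraicComplexity.totalDegree_perPoly_holds (n := Fin n) (k := ℂ), Fintype.card_fin]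
  rw [hdeg] at he
  exact absurd (hn P hP hd) (not_lt.mpr he)

end Summit.ValiantsHypothesis.ValiantsHypothesis.Theses.SummationBits
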